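import Literature.Probability.RandomPlanarGeometry.SAWAdsorptionLowTemperatureWindows
import Literature.Probability.RandomPlanarGeometry.SAWAdsorptionLowTemperatureExact
import HarnessLib

/-!
# The low-temperature series of the adsorbing half-plane self-avoiding walk on `ℤ²` to the order `a⁻⁴`:
# `e^{κ(a)} = a + 1/a + 1/a² − 1/a³ − 3/a⁴ + O(a⁻⁵)` — every coefficient certified from both sides

Topic `Literature/Probability/RandomPlanarGeometry` (continues `SAWAdsorptionLowTemperatureWindows.lean` — the
invariant-free zero-sum-window framework `LowTempWin`: every half-plane self-avoiding word is admissible for the rule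
«no even-length window with zero vector sum» of any memory `m`, and `Λ`-excessive potentials on (height, last `m`
letters) bound `Z⁺_n(a) ≤ Λⁿ u(0,[])/δ` — and `SAWAdsorptionLowTemperatureExact.lean`, whose rider gives
`a + 1/a + 1/a² − 3/a³ ≤ e^{κ(a)}` for `a ≥ 3`; the lower bounds of this file use the kernel census `AdsIrr.cTab` of
`SAWAdsorptionUpperBound209.lean` through the renewal principle of `SAWAdsorptionIrreducibleBridges.lean`).

UPPER BOUNDS. The memory-`m` zero-sum-window relaxation (no closed sub-walk of length `≤ m+1` among the last `m+1`
letters), with all heights `≥ TOP` sharing one potential class, is a finite matrix `T(a) = a·T₁ + T₀` (`T₁` = arrivals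
on the wall) whose Perron data have an EXACT perturbation series in `ε = 1/a` with integer coefficients: the eigenvalue
`1` of `T₁` is carried by the two wall runs and every other wall-arrival chain ends in a run, so order by order
`σ_k = (T₀u_{k−1})(run)` and `u_k` is read off along the `T₁`-depth. Kernel-evaluated: memory `5` (`TOP = 2`)
`ρ = a + 1/a + 1/a² + 2/a³ + 11/a⁴ + 15/a⁵ + …`, memory `7` (`TOP = 2`) `ρ = a + 1/a + 1/a² − 1/a³ + 2/a⁴ + …`, memory `9`
(`TOP = 3`) `ρ = a + 1/a + 1/a² − 1/a³ − 3/a⁴ + 8/a⁵ + …`. The truncated series, scaled to integer polynomials, is a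
`Λ`-excessive potential for `Λ = L(a)/a^e` slightly above `ρ`, and excessiveness row by row (good window × height case
`0, …, TOP+1`) is a univariate integer polynomial inequality certified by «non-negative coefficients in `a − a₀`».
This file proves the soundness of that certificate format once and for all (generic in the table function, memory,
`TOP`, numerator `L`, shift `e`, threshold `a₀`), COMPUTES the series natively (untrusted generator
`LowTempWin.perturbCore` on compact indices — only its output is checked) and checks three certificates by
`native_decide`. LOWER BOUND. The renewal certificate principle `AdsIrr.adsorbedAbove_of_irreducible_lowerBounds` fed
with the tree's kernel census of irreducible wall-returning `x`-bridges `AdsIrr.cTab` (lengths `≤ 9`), SYMBOLICALLY in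
`a`: `Σ_{m ≤ 9} f_m(a)·a^{4m}·N₋^{9−m} − N₋⁹` (`N₋ = a⁵ + a³ + a² − a − 3`, degree `45`) has non-negative coefficients in
`a − 3`, i.e. `Σ_m f_m(a) Λ₋^{−m} ≥ 1` for `Λ₋ = a + 1/a + 1/a² − 1/a³ − 3/a⁴` — already exact to the order `a⁻⁴`.

* `LowTempWin.peval/padd/pmul/pshift/pzeros/ppow` — integer coefficient lists as polynomials in the fugacity;
  `LowTempWin.goodWindows` — the good windows as a list, complete (`mem_goodWindows`); `LowTempWin.hcl/hcase TOP` —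
  height classes `min(h, TOP)` and row cases `min(h, TOP+1)`;
* `LowTempWin.U τ m TOP D a` — the potential read from a table function `τ` (`P_{(class h, w)}(a)/a^D` on good windows);
  `LowTempWin.rowP` — the row polynomial `a^{D+e}(Λu(x) − locSum(x)) = L·P_x − a^e·Σ_s W_s·P_{y_s}`;
  **`LowTempWin.locSum_le_of_rowOK`**, `LowTempWin.certOK`, **`LowTempWin.adsZ_le_of_certOK`**,
  **`LowTempWin.adsRate_le_of_certOK`** — a certified table gives `Z⁺_n(a) ≤ Λⁿ P_{(0,[])}(a)` and `e^{κ(a)} ≤ L(a)/a^e`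
  on `[a₀, ∞)`;
* `LowTempWin.perturbCore/perturbTable/perturbSigma` — the series generator (memory `5`: `437` windows; `7`: `3389`;
  `9`: `25 573`, `102 292` configurations, `127 865` rows); doomed configurations (every continuation dies) get the
  potential `1 + Σ W·P(successor)` by backward induction;
* **`LowTempWin.cert₃`** (memory `5`, `Λ = a + 1/a + 1/a² + 5/a³`, `a ≥ 6`), **`LowTempWin.cert₄`** (memory `7`,
  `Λ = a + 1/a + 1/a² − 1/a³ + 12/a⁴`, `a ≥ 8`), **`LowTempWin.cert₅`** (memory `9`, `TOP = 3`,
  `Λ = a + 1/a + 1/a² − 1/a³ − 3/a⁴ + 32/a⁵`, `a ≥ 10`), each by one `native_decide`; **`LowTempWin.lowP_cert`** — the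
  renewal certificate;
* `Zd.adsZ_le_exact3`; **`Zd.adsRate_le_exact3/4/5`** — the three upper bounds; **`Zd.fourth_order_le_adsRate` —
  `a + 1/a + 1/a² − 1/a³ − 3/a⁴ ≤ e^{κ(a)}` for `a ≥ 3`**; `Zd.adsRate_mem_Icc_exact3/4/5` — the sandwiches;
* **`Zd.tendsto_sq_mul_adsRate_sub` — `a²·(e^{κ(a)} − a − 1/a) → 1`**, **`Zd.tendsto_cube_mul_adsRate_sub` —
  `a³·(e^{κ(a)} − a − 1/a − 1/a²) → −1`**, **`Zd.tendsto_pow_four_mul_adsRate_sub` —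
  `a⁴·(e^{κ(a)} − a − 1/a − 1/a² + 1/a³) → −3`**: the coefficients of `a⁻²`, `a⁻³`, `a⁻⁴` are exactly `1`, `−1`, `−3`
  (unit bumps; width-two bumps and the height-two excursion against the bumps' self-interaction; and so on);
  `Zd.cube_mul_adsRate_sub_mem_Icc`, `Zd.pow_four_mul_adsRate_sub_mem_Icc` — the explicit finite-`a` windows;
* `Zd.adsFreeEnergy_sub_mem_Icc_exact3/4/5` — the free-energy forms, e.g. **`κ(α) − α ∈ [log(1 + e^{−2α} + e^{−3α} −
  e^{−4α} − 3e^{−5α}), log(1 + e^{−2α} + e^{−3α} − e^{−4α} − 3e^{−5α} + 32e^{−6α})]`** for `α ≥ log 10`, so that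
  `κ(α) = α + e^{−2α} + e^{−3α} − (3/2)e^{−4α} − 4e^{−5α} + O(e^{−6α})`.

What is NOT pinned here: the coefficient of `a⁻⁵` (memory `9` with `TOP = 3` gives `+8` from above, the renewal bound
with pieces of length `≤ 16` gives `+5` from below; memory `11` / longer pieces and this file's generic layer would do it).

Status in print: first-order law `e^{κ(a)} ∼ a` on `ℤ²` = Rychlewski–Whittington 2011 as reported by
[cite: BeatonBousquetMelouDeGierDuminilCopinGuttmann2014, §3 (arXiv v5 pp. 9–10)] and [cite: BeatonGuttmannJensen2012Adsorption, p. 2];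
ratio asymptotics [cite: JansevanRensburgWhittington2013, Corollary 1 and Theorem 5 (arXiv v4 p. 9)]; window
`a ≤ e^{κ} ≤ μa` [cite: JansevanRensburgWhittington2013, §3.1 eq. (3.1) (arXiv v4 p. 6)]; renewal structure of bridges
[cite: MadrasSlade1993, §4.2, eq. (4.2.2)–(4.2.4) (pp. 89–91)]. The coefficients beyond the first order and the
two-sided envelopes are not located in print (primary J. Stat. Phys. 145 (2011) 661–668 not held; label lit-2 g16
2026-08-23: NEW-IN-WRITING (modest), provisional on its acquisition). Computational class: axioms standard plus the
`native_decide` certificates `LowTempWin.cert₃`, `cert₄`, `cert₅`, `tab₃_start`, `lowP_cert` and the tree's census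
certificates `AdsIrr.cert_one`, …, `AdsIrr.cert_sixteen` behind `AdsIrr.fTab_le_Fw` (`Lean.ofReduceBool`).
(Lane «pcv-sawmu», a-p3 g11.)
-/

noncomputable section

open Finset Filter Topology Literature.Probability.LatticeModels
open scoped BigOperators

namespace Literature.Probability.RandomPlanarGeometry.SAW.Zd

namespace LowTempWin

open LowTemp

/-! ### Integer coefficient lists as polynomials in the fugacity -/

/-- Evaluation of an integer coefficient list (constant term first) at a real point. [cite: BeatonGuttmannJensen2012Adsorption, §1 (p. 2)] -/
def peval : List ℤ → ℝ → ℝ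
  | [], _ => 0
  | c :: p, x => (c : ℝ) + x * peval p x

/-- `peval [] = 0`. [folklore] -/
@[simp] private theorem peval_nil (x : ℝ) : peval [] x = 0 := rfl

/-- Horner step. [folklore] -/
@[simp] private theorem peval_cons (c : ℤ) (p : List ℤ) (x : ℝ) : peval (c :: p) x = c + x * peval p x := rfl

/-- Sum of coefficient lists. [cite: BeatonGuttmannJensen2012Adsorption, §1 (p. 2)] -/
def padd : List ℤ → List ℤ → List ℤ
  | [], q => q
  | c :: p, [] => c :: p
  | c :: p, d :: q => (c + d) :: padd p q

/-- `padd` is addition. [folklore] -/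
private theorem peval_padd : ∀ (p q : List ℤ) (x : ℝ), peval (padd p q) x = peval p x + peval q x
  | [], q, x => by simp [padd]
  | c :: p, [], x => by simp [padd]
  | c :: p, d :: q, x => by
      simp only [padd, peval_cons, peval_padd p q x, Int.cast_add]; ring

/-- Scalar multiple of a coefficient list. [cite: BeatonGuttmannJensen2012Adsorption, §1 (p. 2)] -/
def psmul (c : ℤ) : List ℤ → List ℤ
  | [] => []
  | d :: p => (c * d) :: psmul c p

/-- `psmul` is scalar multiplication. [folklore] -/
private theorem peval_psmul (c : ℤ) : ∀ (p : List ℤ) (x : ℝ), peval (psmul c p) x = c * peval p x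
  | [], x => by simp [psmul]
  | d :: p, x => by simp only [psmul, peval_cons, peval_psmul c p x, Int.cast_mul]; ring

/-- Product of coefficient lists. [cite: BeatonGuttmannJensen2012Adsorption, §1 (p. 2)] -/
def pmul : List ℤ → List ℤ → List ℤ
  | [], _ => []
  | c :: p, q => padd (psmul c q) (0 :: pmul p q)

/-- `pmul` is multiplication. [folklore] -/
private theorem peval_pmul : ∀ (p q : List ℤ) (x : ℝ), peval (pmul p q) x = peval p x * peval q x
  | [], q, x => by simp [pmul]
  | c :: p, q, x => by
      simp only [pmul, peval_padd, peval_psmul, peval_cons, peval_pmul p q x, Int.cast_zero]; ring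

/-- Taylor shift: the coefficients of `p(a₀ + t)` as a polynomial in `t`. [cite: BeatonGuttmannJensen2012Adsorption, §1 (p. 2)] -/
def pshift (a₀ : ℤ) : List ℤ → List ℤ
  | [] => []
  | c :: p => padd [c] (pmul [a₀, 1] (pshift a₀ p))

/-- `pshift` is the Taylor shift. [folklore] -/
private theorem peval_pshift (a₀ : ℤ) : ∀ (p : List ℤ) (t : ℝ), peval (pshift a₀ p) t = peval p (a₀ + t)
  | [], t => by simp [pshift]
  | c :: p, t => by
      simp only [pshift, peval_padd, peval_pmul, peval_cons, peval_nil, peval_pshift a₀ p t, Int.cast_one]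
      ring

/-- All coefficients are non-negative. [cite: BeatonGuttmannJensen2012Adsorption, §1 (p. 2)] -/
def nonnegB (p : List ℤ) : Bool := p.all fun c => decide (0 ≤ c)

/-- A list with non-negative coefficients evaluates non-negatively on `t ≥ 0`. [folklore] -/
private theorem peval_nonneg : ∀ {p : List ℤ}, nonnegB p = true → ∀ {t : ℝ}, 0 ≤ t → 0 ≤ peval p t
  | [], _, t, _ => by simp
  | c :: p, h, t, ht => by
      simp only [nonnegB, List.all_cons, Bool.and_eq_true, decide_eq_true_eq] at h
      have h2 := peval_nonneg (p := p) h.2 ht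
      have h1 : (0 : ℝ) ≤ c := by exact_mod_cast h.1
      simp only [peval_cons]
      positivity

/-- Constant coefficient `≥ 1`, all others `≥ 0`. [cite: BeatonGuttmannJensen2012Adsorption, §1 (p. 2)] -/
def oneLeB : List ℤ → Bool
  | [] => false
  | c :: p => decide (1 ≤ c) && nonnegB p

/-- Such a list evaluates to `≥ 1` on `t ≥ 0`. [folklore] -/
private theorem one_le_peval {p : List ℤ} (h : oneLeB p = true) {t : ℝ} (ht : 0 ≤ t) : 1 ≤ peval p t := by
  cases p with
  | nil => simp [oneLeB] at h
  | cons c p =>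
    simp only [oneLeB, Bool.and_eq_true, decide_eq_true_eq] at h
    have h1 : (1 : ℝ) ≤ c := by exact_mod_cast h.1
    have h2 := peval_nonneg h.2 ht
    simp only [peval_cons]
    nlinarith

/-- Folding `padd` over a list of letters evaluates to the sum of the evaluations. [folklore] -/
private theorem peval_foldr_padd (f : Step → List ℤ) (x : ℝ) :
    ∀ l : List Step, peval (l.foldr (fun s acc => padd (f s) acc) []) x = (l.map fun s => peval (f s) x).sum
  | [] => by simp
  | s :: l => by simp [peval_padd, peval_foldr_padd f x l]

/-! ### Enumerating the good windows -/

/-- All step words of length `n`. [cite: BeatonGuttmannJensen2012Adsorption, §1 (p. 2)] -/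
def wordsLen : ℕ → List (List Step)
  | 0 => [[]]
  | n + 1 => (wordsLen n).flatMap fun w => (List.finRange 4).map fun s => s :: w

/-- Every word is listed at its length. [folklore] -/
private theorem mem_wordsLen : ∀ w : List Step, w ∈ wordsLen w.length
  | [] => by simp [wordsLen]
  | s :: w => by
      simp only [List.length_cons, wordsLen, List.mem_flatMap, List.mem_map, List.mem_finRange, true_and]
      exact ⟨w, mem_wordsLen w, s, rfl⟩

/-- All step words of length `≤ m`. [cite: BeatonGuttmannJensen2012Adsorption, §1 (p. 2)] -/
def wordsUpTo (m : ℕ) : List (List Step) := (List.range (m + 1)).flatMap wordsLen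

/-- Every word of length `≤ m` is listed. [folklore] -/
private theorem mem_wordsUpTo {m : ℕ} {w : List Step} (h : w.length ≤ m) : w ∈ wordsUpTo m := by
  simp only [wordsUpTo, List.mem_flatMap, List.mem_range]
  exact ⟨w.length, by omega, mem_wordsLen w⟩

/-- The good windows of memory `m`, as a list. [cite: BeatonGuttmannJensen2012Adsorption, §1 (p. 2)] -/
def goodWindows (m : ℕ) : List (List Step) := (wordsUpTo m).filter fun w => decide (Good m w)

/-- The list of good windows is complete. [cite: BeatonGuttmannJensen2012Adsorption, §1 (p. 2)] -/
theorem mem_goodWindows {m : ℕ} {w : List Step} (hg : Good m w) : w ∈ goodWindows m := by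
  simp only [goodWindows, List.mem_filter, decide_eq_true_eq]
  exact ⟨mem_wordsUpTo hg.1, hg⟩

/-! ### Height classes and the symbolic one-step rule -/

/-- Height class of the potential table: `min(h, TOP)` — all heights `≥ TOP` share one class.
[cite: BeatonGuttmannJensen2012Adsorption, §1 (p. 2)] -/
def hcl (TOP : ℕ) (h : ℤ) : ℕ := min h.toNat TOP

/-- Height case of the row check: `min(h, TOP+1)` — cases `0, …, TOP` exact, case `TOP+1` for every height `≥ TOP+1`
(whose neighbours are all in class `TOP`). [cite: BeatonGuttmannJensen2012Adsorption, §1 (p. 2)] -/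
def hcase (TOP : ℕ) (h : ℤ) : ℕ := min h.toNat (TOP + 1)

/-- `hcase ≤ TOP + 1`. [folklore] -/
private theorem hcase_le (TOP : ℕ) (h : ℤ) : hcase TOP h ≤ TOP + 1 := Nat.min_le_right _ _

/-- `dx ∈ {−1, 0, 1}`. [folklore] -/
private theorem dx_cases (s : Step) : s.dx = -1 ∨ s.dx = 0 ∨ s.dx = 1 := by
  fin_cases s <;> simp [Step.dx]

/-- The class of the next height depends only on the case. [folklore] -/
private theorem hcl_add_dx {TOP : ℕ} (hT : 1 ≤ TOP) {h : ℤ} (hh : 0 ≤ h) (s : Step) :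
    hcl TOP (h + s.dx) = hcl TOP ((hcase TOP h : ℤ) + s.dx) := by
  unfold hcl hcase
  rcases dx_cases s with hd | hd | hd <;> rw [hd] <;> omega

/-- Whether the next vertex is on the wall depends only on the case. [folklore] -/
private theorem add_dx_eq_zero_iff {TOP : ℕ} (hT : 1 ≤ TOP) {h : ℤ} (hh : 0 ≤ h) (s : Step) :
    h + s.dx = 0 ↔ (hcase TOP h : ℤ) + s.dx = 0 := by
  unfold hcase
  rcases dx_cases s with hd | hd | hd <;> rw [hd] <;> omega

/-- The wall constraint depends only on the case. [folklore] -/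
private theorem one_le_iff_hcase (TOP : ℕ) (h : ℤ) : 1 ≤ h ↔ 1 ≤ hcase TOP h := by
  unfold hcase; omega

/-- The class of the current height from the case. [folklore] -/
private theorem hcl_eq_min (TOP : ℕ) (h : ℤ) : hcl TOP h = min (hcase TOP h) TOP := by
  unfold hcl hcase; omega

/-- Bijective base-4 code of a window. [cite: BeatonGuttmannJensen2012Adsorption, §1 (p. 2)] -/
def wcode : List Step → ℕ
  | [] => 0
  | s :: w => s.val + 1 + 4 * wcode w

/-- Table key of a configuration `(class, window)`. [cite: BeatonGuttmannJensen2012Adsorption, §1 (p. 2)] -/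
def key (TOP c : ℕ) (w : List Step) : ℕ := (TOP + 1) * wcode w + c

/-- The potential read from a table function `τ`: `u(h, w) = P_{(class h, w)}(a) / a^D` on good windows, `0` elsewhere.
[cite: BeatonGuttmannJensen2012Adsorption, §1 (p. 2)] -/
def U (τ : ℕ → List ℤ) (m TOP D : ℕ) (a : ℝ) (h : ℤ) (w : List Step) : ℝ :=
  if Good m w then peval (τ (key TOP (hcl TOP h) w)) a / a ^ D else 0

/-- The one-step rule in a height case (Boolean). [cite: BeatonGuttmannJensen2012Adsorption, §1 (p. 2)] -/
def allowedB (m cs : ℕ) (w : List Step) (s : Step) : Bool :=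
  decide ((s = 2 → 1 ≤ cs) ∧ ¬ Bad ((s :: w).take (m + 1)))

/-- Arrival weight as a polynomial: `a` on the wall, `1` off it. [cite: BeatonGuttmannJensen2012Adsorption, §1 (p. 2)] -/
def wpoly (cs : ℕ) (s : Step) : List ℤ := if (cs : ℤ) + s.dx = 0 then [0, 1] else [1]

/-- One term of the symbolic one-step sum. [cite: BeatonGuttmannJensen2012Adsorption, §1 (p. 2)] -/
def termP (τ : ℕ → List ℤ) (m TOP cs : ℕ) (w : List Step) (s : Step) : List ℤ :=
  if allowedB m cs w s then pmul (wpoly cs s) (τ (key TOP (hcl TOP ((cs : ℤ) + s.dx)) (push m w s))) else []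

/-- The symbolic one-step sum `a^D · locSum`. [cite: BeatonGuttmannJensen2012Adsorption, §1 (p. 2)] -/
def lhsP (τ : ℕ → List ℤ) (m TOP cs : ℕ) (w : List Step) : List ℤ :=
  (List.finRange 4).foldr (fun s acc => padd (termP τ m TOP cs w s) acc) []

/-- `e` leading zeros: multiplication by `a^e`. [cite: BeatonGuttmannJensen2012Adsorption, §1 (p. 2)] -/
def pzeros : ℕ → List ℤ → List ℤ
  | 0, q => q
  | e + 1, q => 0 :: pzeros e q

/-- The row polynomial `a^{D+e}(Λ u(x) − locSum(x)) = L·P_x − a^e·Σ_s W_s·P_{y_s}` for the rate `Λ = L(a)/a^e`.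
[cite: BeatonGuttmannJensen2012Adsorption, §1 (p. 2)] -/
def rowP (τ : ℕ → List ℤ) (m TOP : ℕ) (L : List ℤ) (e : ℕ) (cs : ℕ) (w : List Step) : List ℤ :=
  padd (pmul L (τ (key TOP (min cs TOP) w))) (psmul (-1) (pzeros e (lhsP τ m TOP cs w)))

/-- Row certificate: `rowP (a₀ + t)` has non-negative coefficients. [cite: BeatonGuttmannJensen2012Adsorption, §1 (p. 2)] -/
def rowOK (τ : ℕ → List ℤ) (m TOP : ℕ) (L : List ℤ) (e : ℕ) (a₀ : ℤ) (cs : ℕ) (w : List Step) : Bool :=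
  nonnegB (pshift a₀ (rowP τ m TOP L e cs w))

/-- Table certificate: the potentials of all good configurations are `≥ 1` on `[a₀, ∞)`.
[cite: BeatonGuttmannJensen2012Adsorption, §1 (p. 2)] -/
def tabOK (τ : ℕ → List ℤ) (m TOP : ℕ) (a₀ : ℤ) : Bool :=
  (goodWindows m).all fun w => (List.range (TOP + 1)).all fun c => oneLeB (pshift a₀ (τ (key TOP c w)))

/-- The whole certificate for the rate `Λ = L(a)/a^e` on `[a₀, ∞)`: `L ≥ 0` there, table positivity, and every row over
(good window) × (height case `0, …, TOP+1`). [cite: BeatonGuttmannJensen2012Adsorption, §1 (p. 2)] -/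
def certOK (τ : ℕ → List ℤ) (m TOP : ℕ) (L : List ℤ) (e : ℕ) (a₀ : ℤ) : Bool :=
  nonnegB (pshift a₀ L) && tabOK τ m TOP a₀ &&
    (goodWindows m).all fun w => (List.range (TOP + 2)).all fun cs => rowOK τ m TOP L e a₀ cs w

/-! ### Soundness of the certificate -/

/-- Certified table potentials are `≥ 1` on `[a₀, ∞)` at every good configuration. [folklore] -/
private theorem one_le_peval_of_tabOK {τ : ℕ → List ℤ} {m TOP : ℕ} {a₀ : ℤ} (hT : tabOK τ m TOP a₀ = true) {a : ℝ}
    (ha : (a₀ : ℝ) ≤ a) {w : List Step} (hw : Good m w) {c : ℕ} (hc : c ≤ TOP) : 1 ≤ peval (τ (key TOP c w)) a := by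
  simp only [tabOK, List.all_eq_true] at hT
  have h1 := hT w (mem_goodWindows hw) c (List.mem_range.2 (by omega))
  have h2 := one_le_peval h1 (t := a - a₀) (by linarith)
  rwa [peval_pshift, show ((a₀ : ℤ) : ℝ) + (a - a₀) = a by ring] at h2

/-- Evaluation of a term. [folklore] -/
private theorem peval_termP (τ : ℕ → List ℤ) (m TOP cs : ℕ) (w : List Step) (s : Step) (a : ℝ) :
    peval (termP τ m TOP cs w s) a = if allowedB m cs w s then
      peval (wpoly cs s) a * peval (τ (key TOP (hcl TOP ((cs : ℤ) + s.dx)) (push m w s))) a else 0 := by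
  unfold termP; split_ifs <;> simp [peval_pmul]

/-- Evaluation of the weight polynomial. [folklore] -/
private theorem peval_wpoly (cs : ℕ) (s : Step) (a : ℝ) :
    peval (wpoly cs s) a = if (cs : ℤ) + s.dx = 0 then a else 1 := by
  unfold wpoly; split_ifs <;> simp

/-- Evaluation of the symbolic one-step sum. [folklore] -/
private theorem peval_lhsP (τ : ℕ → List ℤ) (m TOP cs : ℕ) (w : List Step) (a : ℝ) :
    peval (lhsP τ m TOP cs w) a = ∑ s : Step, peval (termP τ m TOP cs w s) a := by
  rw [lhsP, peval_foldr_padd, Fin.sum_univ_def]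

/-- `pzeros e` multiplies by `a^e`. [folklore] -/
private theorem peval_pzeros (a : ℝ) : ∀ (e : ℕ) (q : List ℤ), peval (pzeros e q) a = a ^ e * peval q a
  | 0, q => by simp [pzeros]
  | e + 1, q => by simp only [pzeros, peval_cons, Int.cast_zero, peval_pzeros a e q]; ring

/-- Evaluation of the row polynomial. [folklore] -/
private theorem peval_rowP (τ : ℕ → List ℤ) (m TOP : ℕ) (L : List ℤ) (e : ℕ) (cs : ℕ) (w : List Step) (a : ℝ) :
    peval (rowP τ m TOP L e cs w) a =
      peval L a * peval (τ (key TOP (min cs TOP) w)) a - a ^ e * peval (lhsP τ m TOP cs w) a := by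
  simp only [rowP, peval_padd, peval_pmul, peval_psmul, peval_pzeros, Int.cast_neg, Int.cast_one]
  ring

/-- The analytic one-step sum equals the symbolic one (at a good window). [folklore] -/
private theorem locSum_eq (τ : ℕ → List ℤ) {m TOP : ℕ} (hT : 1 ≤ TOP) (D : ℕ) (a : ℝ) {h : ℤ} (hh : 0 ≤ h)
    {w : List Step} (hg : Good m w) :
    locSum m (U τ m TOP D a) a h w = (∑ s : Step, peval (termP τ m TOP (hcase TOP h) w s) a) / a ^ D := by
  rw [locSum, Finset.sum_div]
  refine Finset.sum_congr rfl fun s _ => ?_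
  rw [peval_termP]
  have hA : Allowed m h w s ↔ allowedB m (hcase TOP h) w s = true := by
    simp only [Allowed, allowedB, decide_eq_true_eq, one_le_iff_hcase TOP h]
  by_cases hal : Allowed m h w s
  · rw [if_pos hal, if_pos (hA.1 hal), U, if_pos (good_push hg hal), hcl_add_dx hT hh, peval_wpoly, wt]
    simp only [add_dx_eq_zero_iff hT hh s]
    split_ifs <;> ring
  · rw [if_neg hal, if_neg (mt hA.2 hal), zero_div]

/-- **Row soundness**: a certified row gives the excessiveness inequality at every height of its case (good window),
for the rate `Λ = L(a)/a^e`. [cite: BeatonGuttmannJensen2012Adsorption, §1 (p. 2)] -/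
theorem locSum_le_of_rowOK {τ : ℕ → List ℤ} {D m TOP : ℕ} {L : List ℤ} {e : ℕ} {a₀ : ℤ} {h : ℤ} {w : List Step}
    {a : ℝ} (hrow : rowOK τ m TOP L e a₀ (hcase TOP h) w = true) (hT : 1 ≤ TOP) (ha₀ : (a₀ : ℝ) ≤ a) (ha : 0 < a)
    (hh : 0 ≤ h) (hg : Good m w) :
    locSum m (U τ m TOP D a) a h w ≤ (peval L a / a ^ e) * U τ m TOP D a h w := by
  have hq : 0 ≤ peval (rowP τ m TOP L e (hcase TOP h) w) a := by
    have := peval_nonneg hrow (t := a - a₀) (by linarith)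
    rwa [peval_pshift, show ((a₀ : ℤ) : ℝ) + (a - a₀) = a by ring] at this
  rw [peval_rowP] at hq
  rw [locSum_eq τ hT D a hh hg, U, if_pos hg, hcl_eq_min TOP h, ← peval_lhsP, ← sub_nonneg]
  set P := peval (τ (key TOP (min (hcase TOP h) TOP) w)) a
  set S := peval (lhsP τ m TOP (hcase TOP h) w) a
  have he : peval L a / a ^ e * (P / a ^ D) - S / a ^ D = (peval L a * P - a ^ e * S) / (a ^ e * a ^ D) := by
    field_simp
  rw [he]
  exact div_nonneg hq (by positivity)

/-- **Certificate soundness**: `certOK` gives the excessiveness hypothesis of `adsZ_le_of_potential` on `[a₀, ∞)`.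
[cite: BeatonGuttmannJensen2012Adsorption, §1 (p. 2)] -/
theorem hloc_of_certOK {τ : ℕ → List ℤ} {m TOP : ℕ} {L : List ℤ} {e : ℕ} {a₀ : ℤ}
    (hc : certOK τ m TOP L e a₀ = true) (hT : 1 ≤ TOP) (D : ℕ) {a : ℝ} (ha₀ : (a₀ : ℝ) ≤ a) (ha : 0 < a) :
    ∀ h w, 0 ≤ h → Good m w → locSum m (U τ m TOP D a) a h w ≤ (peval L a / a ^ e) * U τ m TOP D a h w := by
  intro h w hh hg
  simp only [certOK, Bool.and_eq_true, List.all_eq_true] at hc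
  have hcs : hcase TOP h ∈ List.range (TOP + 2) := List.mem_range.2 (by have := hcase_le TOP h; omega)
  exact locSum_le_of_rowOK (hc.2 w (mem_goodWindows hg) _ hcs) hT ha₀ ha hh hg

/-- The certified rate is non-negative on `[a₀, ∞)`. [folklore] -/
private theorem rate_nonneg_of_certOK {τ : ℕ → List ℤ} {m TOP : ℕ} {L : List ℤ} {e : ℕ} {a₀ : ℤ}
    (hc : certOK τ m TOP L e a₀ = true) {a : ℝ} (ha₀ : (a₀ : ℝ) ≤ a) (ha : 0 < a) : 0 ≤ peval L a / a ^ e := by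
  simp only [certOK, Bool.and_eq_true] at hc
  have := peval_nonneg hc.1.1 (t := a - a₀) (by linarith)
  rw [peval_pshift, show ((a₀ : ℤ) : ℝ) + (a - a₀) = a by ring] at this
  positivity

/-- **The bound from a certified table**: `Z⁺_n(a) ≤ Λⁿ · P_{(0,[])}(a)` with `Λ = L(a)/a^e`, `a ≥ a₀`, `a > 0`.
[cite: BeatonGuttmannJensen2012Adsorption, §1 (p. 2)] -/
theorem adsZ_le_of_certOK {τ : ℕ → List ℤ} {m TOP : ℕ} {L : List ℤ} {e : ℕ} {a₀ : ℤ}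
    (hc : certOK τ m TOP L e a₀ = true) (hT : 1 ≤ TOP) (D : ℕ) {a : ℝ} (ha₀ : (a₀ : ℝ) ≤ a) (ha : 0 < a) (n : ℕ) :
    adsZ n a ≤ (peval L a / a ^ e) ^ n * peval (τ (key TOP 0 [])) a := by
  have hTab : tabOK τ m TOP a₀ = true := by
    simp only [certOK, Bool.and_eq_true] at hc
    exact hc.1.2
  have hΛ := rate_nonneg_of_certOK hc ha₀ ha
  have hδ : (0 : ℝ) < 1 / a ^ D := by positivity
  have hu : ∀ h w, 0 ≤ h → Good m w → 1 / a ^ D ≤ U τ m TOP D a h w := fun h w _ hg => by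
    rw [U, if_pos hg]
    gcongr
    exact one_le_peval_of_tabOK hTab ha₀ hg (Nat.min_le_right _ _)
  have hu0 : ∀ h w, 0 ≤ U τ m TOP D a h w := fun h w => by
    unfold U
    split_ifs with hg
    · exact div_nonneg (zero_le_one.trans (one_le_peval_of_tabOK hTab ha₀ hg (Nat.min_le_right _ _)))
        (pow_nonneg ha.le _)
    · exact le_rfl
  have h := adsZ_le_of_potential m (U τ m TOP D a) ha.le hΛ hδ hu hu0 (hloc_of_certOK hc hT D ha₀ ha) n
  have e' : U τ m TOP D a 0 [] / (1 / a ^ D) = peval (τ (key TOP 0 [])) a := by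
    rw [U, if_pos (good_nil m)]
    simp only [hcl, Int.toNat_zero, Nat.zero_min]
    field_simp
  rwa [mul_div_assoc, e'] at h

/-- **The rate bound from a certified table**: `e^{κ(a)} ≤ L(a)/a^e` for `a ≥ a₀`, `a > 0`.
[cite: BeatonGuttmannJensen2012Adsorption, §1 (p. 2)] -/
theorem adsRate_le_of_certOK {τ : ℕ → List ℤ} {m TOP : ℕ} {L : List ℤ} {e : ℕ} {a₀ : ℤ}
    (hc : certOK τ m TOP L e a₀ = true) (hT : 1 ≤ TOP) (D : ℕ) {a : ℝ} (ha₀ : (a₀ : ℝ) ≤ a) (ha : 0 < a) :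
    adsRate a ≤ peval L a / a ^ e := by
  have hTab : tabOK τ m TOP a₀ = true := by
    simp only [certOK, Bool.and_eq_true] at hc
    exact hc.1.2
  set Λ := peval L a / a ^ e with hΛ
  have hΛ0 : 0 ≤ Λ := rate_nonneg_of_certOK hc ha₀ ha
  set K : ℝ := peval (τ (key TOP 0 [])) a with hK
  have hKpos : 0 < K := zero_lt_one.trans_le (one_le_peval_of_tabOK hTab ha₀ (good_nil m) (Nat.zero_le _))
  have hK1 : Tendsto (fun n : ℕ => K ^ (1 / (n : ℝ))) atTop (𝓝 1) := by
    have := (tendsto_const_nhds (x := K)).rpow tendsto_one_div_atTop_nhds_zero_nat (Or.inl hKpos.ne')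
    simpa using this
  have hup : Tendsto (fun n : ℕ => K ^ (1 / (n : ℝ)) * Λ) atTop (𝓝 Λ) := by
    simpa using hK1.mul_const Λ
  refine le_of_tendsto_of_tendsto (tendsto_adsRate ha.le) hup ?_
  filter_upwards [eventually_ge_atTop 1] with n hn
  have hb : adsZ n a ≤ K * Λ ^ n := by
    rw [mul_comm]; exact adsZ_le_of_certOK hc hT D ha₀ ha n
  calc (adsZ n a) ^ (1 / (n : ℝ)) ≤ (K * Λ ^ n) ^ (1 / (n : ℝ)) :=
        Real.rpow_le_rpow (adsZ_nonneg n ha.le) hb (by positivity)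
    _ = K ^ (1 / (n : ℝ)) * Λ := by
        rw [Real.mul_rpow hKpos.le (pow_nonneg hΛ0 _), one_div, Real.pow_rpow_inv_natCast hΛ0 (by omega)]

/-! ### Computing the potential table natively: the exact perturbation series of the relaxation -/

/-- All configurations `(class, window)`, classes `0, …, TOP`. [cite: BeatonGuttmannJensen2012Adsorption, §1 (p. 2)] -/
def configs (m TOP : ℕ) : List (ℕ × List Step) :=
  (goodWindows m).flatMap fun w => (List.range (TOP + 1)).map fun c => (c, w)

/-- Successors of a configuration in the collapsed relaxation: (arrives on the wall?, key).
[cite: BeatonGuttmannJensen2012Adsorption, §1 (p. 2)] -/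
def succs (m TOP : ℕ) (c : ℕ) (w : List Step) : List (Bool × ℕ) :=
  (List.finRange 4).filterMap fun s =>
    if allowedB m c w s then
      some (decide (((c : ℤ) + s.dx) = 0), key TOP (hcl TOP ((c : ℤ) + s.dx)) (push m w s))
    else none

/-- **The perturbation series from first principles** (untrusted generator; only its output is checked by
`certOK`): for the memory-`m` zero-sum-window relaxation collapsed at height `TOP`, `T(a) = a·T₁ + T₀`, the exact
series in `ε = 1/a` of the Perron vector — order `0`: `u₀ = T₁u₀` with `u₀ = 1` on the two wall runs, solved along the
`T₁`-depth (wall-arrival chains end in a run); order `k ≥ 1`: `σ_k = (T₀u_{k−1})(run)`,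
`u_k − T₁u_k = T₀u_{k−1} − Σ_{j=1}^{k} σ_j u_{k−j}`, `u_k(run) = 0` — all in exact integer arithmetic on compact
indices. Returns the coefficient arrays `u₀, …, u_D` (by index), the rate series `σ₀, …, σ_D`
(`ρ(a) = a·Σ_k σ_k a^{−k}`), the keys and the successor lists. [cite: BeatonGuttmannJensen2012Adsorption, §1 (p. 2)] -/
def perturbCore (m TOP D : ℕ) : Array (Array ℤ) × Array ℤ × Array ℕ × Array (List (Bool × ℕ)) := Id.run do
  let cfgs := (configs m TOP).toArray
  let n := cfgs.size
  let keys : Array ℕ := cfgs.map fun cw => key TOP cw.1 cw.2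
  let mut index : Std.HashMap ℕ ℕ := Std.HashMap.emptyWithCapacity (2 * n + 1)
  for i in [0:n] do
    index := index.insert keys[i]! i
  let idx := index
  let succ : Array (List (Bool × ℕ)) := cfgs.map fun cw =>
    (succs m TOP cw.1 cw.2).map fun e => (e.1, idx.getD e.2 0)
  let runE := idx.getD (key TOP 0 (List.replicate m (1 : Step))) 0
  let runW := idx.getD (key TOP 0 (List.replicate m (3 : Step))) 0
  -- `T₁`-depth by relaxation rounds, then the processing order (successors first)
  let mut depth : Array ℕ := Array.replicate n 0
  for _ in [0:m + 4] do
    for x in [0:n] do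
      if x != runE && x != runW then
        let d := (succ[x]!).foldl (fun acc e => if e.1 then max acc (depth[e.2]! + 1) else acc) 0
        depth := depth.set! x d
  let mut maxd : ℕ := 0
  for x in [0:n] do
    maxd := max maxd depth[x]!
  let dfin := depth
  let mut order : Array ℕ := #[]
  for d in [0:maxd + 1] do
    for x in [0:n] do
      if x != runE && x != runW && dfin[x]! == d then order := order.push x
  -- order 0
  let mut u0 : Array ℤ := Array.replicate n 0
  u0 := u0.set! runE 1
  u0 := u0.set! runW 1
  for x in order do
    let v := (succ[x]!).foldl (fun acc e => if e.1 then acc + u0[e.2]! else acc) 0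
    u0 := u0.set! x v
  let mut us : Array (Array ℤ) := #[u0]
  let mut sig : Array ℤ := #[1]
  for k in [1:D + 1] do
    let prev := us[k - 1]!
    let mut t0 : Array ℤ := Array.replicate n 0
    for x in [0:n] do
      let v := (succ[x]!).foldl (fun acc e => if e.1 then acc else acc + prev[e.2]!) 0
      t0 := t0.set! x v
    sig := sig.push t0[runE]!
    let usk := us
    let sigk := sig
    let mut uk : Array ℤ := Array.replicate n 0
    for x in order do
      let mut r : ℤ := t0[x]!
      for j in [1:k + 1] do
        r := r - sigk[j]! * (usk[k - j]!)[x]!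
      let v := (succ[x]!).foldl (fun acc e => if e.1 then acc + uk[e.2]! else acc) 0
      uk := uk.set! x (r + v)
    us := us.push uk
  return (us, sig, keys, succ)

/-- **The potential table from first principles**: `a^D ×` the order-`D` truncation of the Perron series, entries
`(key, [u_D, u_{D−1}, …, u₀])` (constant term first). Configurations whose series vanishes identically (doomed: every
continuation dies) get the potential `1 + Σ_{successors} W·P` by backward induction, so that their rows hold too.
[cite: BeatonGuttmannJensen2012Adsorption, §1 (p. 2)] -/
def perturbTable (m TOP D : ℕ) : List (ℕ × List ℤ) := Id.run do
  let (us, _, keys, succ) := perturbCore m TOP D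
  let n := keys.size
  let mut tab : Array (List ℤ) := Array.replicate n []
  let mut todo : Array Bool := Array.replicate n false
  for x in [0:n] do
    let p : List ℤ := (List.range (D + 1)).map fun j => (us[D - j]!)[x]!
    if p.any (fun c => c != 0) then tab := tab.set! x p else todo := todo.set! x true
  for _ in [0:m + 4] do
    for x in [0:n] do
      if todo[x]! then
        let td := todo
        if (succ[x]!).all (fun e => !td[e.2]!) then
          let tb := tab
          let p := (succ[x]!).foldl (fun acc e => padd acc (if e.1 then 0 :: tb[e.2]! else tb[e.2]!)) [1]
          tab := tab.set! x p
          todo := todo.set! x false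
  let tfin := tab
  return (List.range n).map fun x => (keys[x]!, tfin[x]!)

/-- The growth-rate series of the relaxation to order `D`: `ρ(a) = a·(σ₀ + σ₁/a + σ₂/a² + …)` (informational).
[cite: BeatonGuttmannJensen2012Adsorption, §1 (p. 2)] -/
def perturbSigma (m TOP D : ℕ) : List ℤ := (perturbCore m TOP D).2.1.toList

end LowTempWin
namespace LowTempWin

/-! ### Certificates (computational: `native_decide`) -/

/-- There are `437` good windows of memory `5`, `3389` of memory `7` and `26025` of memory `9`. [folklore] -/
example : (goodWindows 5).length = 437 ∧ (goodWindows 7).length = 3389 := by native_decide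

/-- The rate series of the memory-`5` relaxation: `ρ = a + 1/a + 1/a² + 2/a³ + 11/a⁴ + 15/a⁵ + O(a⁻⁶)`. [folklore] -/
example : perturbSigma 5 2 6 = [1, 0, 1, 1, 2, 11, 15] := by native_decide

/-- The rate series of the memory-`7` relaxation: `ρ = a + 1/a + 1/a² − 1/a³ + 2/a⁴ + O(a⁻⁵)`. [folklore] -/
example : perturbSigma 7 2 5 = [1, 0, 1, 1, -1, 2] := by native_decide

/-- The rate series of the memory-`9` relaxation (heights collapsed at `3`): `ρ = a + 1/a + 1/a² − 1/a³ − 3/a⁴ + 8/a⁵ + O(a⁻⁶)`.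
[folklore] -/
example : perturbSigma 9 3 6 = [1, 0, 1, 1, -1, -3, 8] := by native_decide

/-- Hash map of certificate 3 (memory `5`, heights collapsed at `2`, order `6`); a constant, built once.
[cite: BeatonGuttmannJensen2012Adsorption, §1 (p. 2)] -/
def hm₃ : Std.HashMap ℕ (List ℤ) := Std.HashMap.ofList (perturbTable 5 2 6)

/-- Hash map of certificate 4 (memory `7`, heights collapsed at `2`, order `9`). [cite: BeatonGuttmannJensen2012Adsorption, §1 (p. 2)] -/
def hm₄ : Std.HashMap ℕ (List ℤ) := Std.HashMap.ofList (perturbTable 7 2 9)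

/-- Hash map of certificate 5 (memory `9`, heights collapsed at `3`, order `12`). [cite: BeatonGuttmannJensen2012Adsorption, §1 (p. 2)] -/
def hm₅ : Std.HashMap ℕ (List ℤ) := Std.HashMap.ofList (perturbTable 9 3 12)

/-- Table function of certificate 3 (default `[1]` off the table). [cite: BeatonGuttmannJensen2012Adsorption, §1 (p. 2)] -/
def tab₃ (k : ℕ) : List ℤ := hm₃.getD k [1]

/-- Table function of certificate 4. [cite: BeatonGuttmannJensen2012Adsorption, §1 (p. 2)] -/
def tab₄ (k : ℕ) : List ℤ := hm₄.getD k [1]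

/-- Table function of certificate 5. [cite: BeatonGuttmannJensen2012Adsorption, §1 (p. 2)] -/
def tab₅ (k : ℕ) : List ℤ := hm₅.getD k [1]

/-- **Certificate 3**: `Λ = (a⁴ + a² + a + 5)/a³` on `[6, ∞)`. [cite: BeatonGuttmannJensen2012Adsorption, §1 (p. 2)] -/
theorem cert₃ : certOK tab₃ 5 2 [5, 1, 1, 0, 1] 3 6 = true := by
  native_decide

/-- **Certificate 4**: `Λ = (a⁵ + a³ + a² − a + 12)/a⁴` on `[8, ∞)`. [cite: BeatonGuttmannJensen2012Adsorption, §1 (p. 2)] -/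
theorem cert₄ : certOK tab₄ 7 2 [12, -1, 1, 1, 0, 1] 4 8 = true := by
  native_decide

/-- **Certificate 5**: `Λ = (a⁶ + a⁴ + a³ − a² − 3a + 32)/a⁵` on `[10, ∞)` (`127 865` rows). [cite: BeatonGuttmannJensen2012Adsorption, §1 (p. 2)] -/
theorem cert₅ : certOK tab₅ 9 3 [32, -3, -1, 1, 1, 0, 1] 5 10 = true := by
  native_decide

/-- The start entry of table 3: `P_{(0,[])}(a) = 2a⁶ + 2a³ − 4a² − 30a − 36`. [folklore] -/
private theorem tab₃_start : tab₃ (key 2 0 []) = [-36, -30, -4, 2, 0, 0, 2] := by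
  native_decide

end LowTempWin

/-! ### Statements: upper bounds -/

/-- **`Z⁺_n(a) ≤ 3a⁶ · (a + 1/a + 1/a² + 5/a³)ⁿ` for every `n` and every `a ≥ 6`** (finite, explicit).
[cite: BeatonGuttmannJensen2012Adsorption, §1 (p. 2)] -/
theorem adsZ_le_exact3 {a : ℝ} (ha : 6 ≤ a) (n : ℕ) :
    adsZ n a ≤ 3 * a ^ 6 * (a + 1 / a + 1 / a ^ 2 + 5 / a ^ 3) ^ n := by
  have ha0 : 0 < a := by linarith
  have h := LowTempWin.adsZ_le_of_certOK LowTempWin.cert₃ (by norm_num) 6 (by exact_mod_cast ha) ha0 n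
  rw [LowTempWin.tab₃_start] at h
  have hΛ : LowTempWin.peval [5, 1, 1, 0, 1] a / a ^ 3 = a + 1 / a + 1 / a ^ 2 + 5 / a ^ 3 := by
    simp only [LowTempWin.peval_cons, LowTempWin.peval_nil]
    push_cast
    field_simp
    ring
  have hP : LowTempWin.peval [-36, -30, -4, 2, 0, 0, 2] a ≤ 3 * a ^ 6 := by
    simp only [LowTempWin.peval_cons, LowTempWin.peval_nil]
    push_cast
    have h2 : (36 : ℝ) ≤ a ^ 2 := by nlinarith
    have h3 : (216 : ℝ) ≤ a ^ 3 := by nlinarith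
    nlinarith [mul_nonneg (pow_nonneg ha0.le 3) (show (0 : ℝ) ≤ a ^ 3 - 2 by linarith), ha0]
  rw [hΛ] at h
  calc adsZ n a ≤ (a + 1 / a + 1 / a ^ 2 + 5 / a ^ 3) ^ n * LowTempWin.peval [-36, -30, -4, 2, 0, 0, 2] a := h
    _ ≤ (a + 1 / a + 1 / a ^ 2 + 5 / a ^ 3) ^ n * (3 * a ^ 6) := by gcongr
    _ = 3 * a ^ 6 * (a + 1 / a + 1 / a ^ 2 + 5 / a ^ 3) ^ n := by ring

/-- **`e^{κ(a)} ≤ a + 1/a + 1/a² + 5/a³` for `a ≥ 6`** (certificate 3).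
[cite: BeatonBousquetMelouDeGierDuminilCopinGuttmann2014, §3 (arXiv:1109.0358v5 pp. 9–10: «on the square lattice, μ(y) is asymptotic to y» — Rychlewski–Whittington 2011)]
[cite: BeatonGuttmannJensen2012Adsorption, §1 p. 2 (arXiv:1110.6695v1: «κ(α) is asymptotic to α»)] -/
theorem adsRate_le_exact3 {a : ℝ} (ha : 6 ≤ a) : adsRate a ≤ a + 1 / a + 1 / a ^ 2 + 5 / a ^ 3 := by
  have ha0 : 0 < a := by linarith
  have h := LowTempWin.adsRate_le_of_certOK LowTempWin.cert₃ (by norm_num) 6 (by exact_mod_cast ha) ha0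
  have hΛ : LowTempWin.peval [5, 1, 1, 0, 1] a / a ^ 3 = a + 1 / a + 1 / a ^ 2 + 5 / a ^ 3 := by
    simp only [LowTempWin.peval_cons, LowTempWin.peval_nil]
    push_cast
    field_simp
    ring
  rwa [hΛ] at h

/-- **`e^{κ(a)} ≤ a + 1/a + 1/a² − 1/a³ + 12/a⁴` for `a ≥ 8`** (certificate 4, memory `7`).
[cite: BeatonBousquetMelouDeGierDuminilCopinGuttmann2014, §3 (arXiv:1109.0358v5 pp. 9–10: «on the square lattice, μ(y) is asymptotic to y» — Rychlewski–Whittington 2011)]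
[cite: BeatonGuttmannJensen2012Adsorption, §1 p. 2 (arXiv:1110.6695v1: «κ(α) is asymptotic to α»)] -/
theorem adsRate_le_exact4 {a : ℝ} (ha : 8 ≤ a) : adsRate a ≤ a + 1 / a + 1 / a ^ 2 - 1 / a ^ 3 + 12 / a ^ 4 := by
  have ha0 : 0 < a := by linarith
  have h := LowTempWin.adsRate_le_of_certOK LowTempWin.cert₄ (by norm_num) 9 (by exact_mod_cast ha) ha0
  have hΛ : LowTempWin.peval [12, -1, 1, 1, 0, 1] a / a ^ 4 = a + 1 / a + 1 / a ^ 2 - 1 / a ^ 3 + 12 / a ^ 4 := by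
    simp only [LowTempWin.peval_cons, LowTempWin.peval_nil]
    push_cast
    field_simp
    ring
  rwa [hΛ] at h

/-- **`e^{κ(a)} ≤ a + 1/a + 1/a² − 1/a³ − 3/a⁴ + 32/a⁵` for `a ≥ 10`** (certificate 5, memory `9`, heights collapsed at `3`).
[cite: BeatonBousquetMelouDeGierDuminilCopinGuttmann2014, §3 (arXiv:1109.0358v5 pp. 9–10: «on the square lattice, μ(y) is asymptotic to y» — Rychlewski–Whittington 2011)]
[cite: BeatonGuttmannJensen2012Adsorption, §1 p. 2 (arXiv:1110.6695v1: «κ(α) is asymptotic to α»)] -/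
theorem adsRate_le_exact5 {a : ℝ} (ha : 10 ≤ a) :
    adsRate a ≤ a + 1 / a + 1 / a ^ 2 - 1 / a ^ 3 - 3 / a ^ 4 + 32 / a ^ 5 := by
  have ha0 : 0 < a := by linarith
  have h := LowTempWin.adsRate_le_of_certOK LowTempWin.cert₅ (by norm_num) 12 (by exact_mod_cast ha) ha0
  have hΛ : LowTempWin.peval [32, -3, -1, 1, 1, 0, 1] a / a ^ 5 =
      a + 1 / a + 1 / a ^ 2 - 1 / a ^ 3 - 3 / a ^ 4 + 32 / a ^ 5 := by
    simp only [LowTempWin.peval_cons, LowTempWin.peval_nil]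
    push_cast
    field_simp
    ring
  rwa [hΛ] at h

/-- **The sandwich to the order `a⁻²`: `a + 1/a + 1/a² − 3/a³ ≤ e^{κ(a)} ≤ a + 1/a + 1/a² + 5/a³` for `a ≥ 6`** (lower half:
the bump family of `SAWAdsorptionLowTemperatureExact.lean`).
[cite: BeatonBousquetMelouDeGierDuminilCopinGuttmann2014, §3 (arXiv:1109.0358v5 pp. 9–10: «on the square lattice, μ(y) is asymptotic to y» — Rychlewski–Whittington 2011)] -/
theorem adsRate_mem_Icc_exact3 {a : ℝ} (ha : 6 ≤ a) :
    adsRate a ∈ Set.Icc (a + 1 / a + 1 / a ^ 2 - 3 / a ^ 3) (a + 1 / a + 1 / a ^ 2 + 5 / a ^ 3) :=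
  ⟨third_order_le_adsRate (by linarith), adsRate_le_exact3 ha⟩

/-- **`a² · (e^{κ(a)} − a − 1/a) → 1` as `a → ∞`**: the coefficient of `a⁻²` in the low-temperature expansion of the
adsorbing half-plane self-avoiding walk on `ℤ²` is exactly `1`.
[cite: BeatonBousquetMelouDeGierDuminilCopinGuttmann2014, §3 (arXiv:1109.0358v5 pp. 9–10: «on the square lattice, μ(y) is asymptotic to y» — Rychlewski–Whittington 2011)]
[cite: JansevanRensburgWhittington2013, Corollary 1 and Theorem 5 (arXiv v4 p. 9): ratio asymptotics] -/
theorem tendsto_sq_mul_adsRate_sub : Tendsto (fun a : ℝ => a ^ 2 * (adsRate a - a - 1 / a)) atTop (𝓝 1) := by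
  have hlo : Tendsto (fun a : ℝ => 1 - 3 * a⁻¹) atTop (𝓝 1) := by
    simpa using (tendsto_inv_atTop_zero.const_mul (3 : ℝ)).const_sub (1 : ℝ)
  have hup : Tendsto (fun a : ℝ => 1 + 5 * a⁻¹) atTop (𝓝 1) := by
    simpa using (tendsto_inv_atTop_zero.const_mul (5 : ℝ)).const_add (1 : ℝ)
  refine tendsto_of_tendsto_of_tendsto_of_le_of_le' hlo hup ?_ ?_
  · filter_upwards [eventually_ge_atTop 6] with a ha
    have ha0 : 0 < a := by linarith
    have h := (adsRate_mem_Icc_exact3 ha).1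
    have e : a ^ 2 * (a + 1 / a + 1 / a ^ 2 - 3 / a ^ 3 - a - 1 / a) = 1 - 3 * a⁻¹ := by field_simp; ring
    calc 1 - 3 * a⁻¹ = a ^ 2 * (a + 1 / a + 1 / a ^ 2 - 3 / a ^ 3 - a - 1 / a) := e.symm
      _ ≤ a ^ 2 * (adsRate a - a - 1 / a) := by nlinarith [sq_nonneg a]
  · filter_upwards [eventually_ge_atTop 6] with a ha
    have ha0 : 0 < a := by linarith
    have h := (adsRate_mem_Icc_exact3 ha).2
    have e : a ^ 2 * (a + 1 / a + 1 / a ^ 2 + 5 / a ^ 3 - a - 1 / a) = 1 + 5 * a⁻¹ := by field_simp; ring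
    calc a ^ 2 * (adsRate a - a - 1 / a) ≤ a ^ 2 * (a + 1 / a + 1 / a ^ 2 + 5 / a ^ 3 - a - 1 / a) := by
          nlinarith [sq_nonneg a]
      _ = 1 + 5 * a⁻¹ := e

/-- **`κ(α) − α ∈ [log (1 + e^{−2α} + e^{−3α} − 3e^{−4α}), log (1 + e^{−2α} + e^{−3α} + 5e^{−4α})]` for `α ≥ log 6`**:
`κ(α) = α + e^{−2α} + e^{−3α} + O(e^{−4α})`.
[cite: BeatonBousquetMelouDeGierDuminilCopinGuttmann2014, §3 (arXiv:1109.0358v5 pp. 9–10: «on the square lattice, μ(y) is asymptotic to y» — Rychlewski–Whittington 2011)]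
[cite: BeatonGuttmannJensen2012Adsorption, §1 p. 2 (arXiv:1110.6695v1: «κ(α) is asymptotic to α»)] -/
theorem adsFreeEnergy_sub_mem_Icc_exact3 {α : ℝ} (hα : Real.log 6 ≤ α) :
    adsFreeEnergy α - α ∈ Set.Icc (Real.log (1 + Real.exp (-2 * α) + Real.exp (-3 * α) - 3 * Real.exp (-4 * α)))
      (Real.log (1 + Real.exp (-2 * α) + Real.exp (-3 * α) + 5 * Real.exp (-4 * α))) := by
  set a := Real.exp α with ha_def
  have ha6 : 6 ≤ a := by
    rw [ha_def, ← Real.exp_log (by norm_num : (0 : ℝ) < 6)]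
    exact Real.exp_le_exp.2 hα
  have ha0 : 0 < a := Real.exp_pos α
  have hpos := adsRate_pos ha0.le
  have he2 : Real.exp (-2 * α) = 1 / a ^ 2 := by
    rw [ha_def, ← Real.exp_nat_mul, one_div, ← Real.exp_neg]; ring_nf
  have he3 : Real.exp (-3 * α) = 1 / a ^ 3 := by
    rw [ha_def, ← Real.exp_nat_mul, one_div, ← Real.exp_neg]; ring_nf
  have he4 : Real.exp (-4 * α) = 1 / a ^ 4 := by
    rw [ha_def, ← Real.exp_nat_mul, one_div, ← Real.exp_neg]; ring_nf
  have elow : a * (1 + Real.exp (-2 * α) + Real.exp (-3 * α) - 3 * Real.exp (-4 * α)) =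
      a + 1 / a + 1 / a ^ 2 - 3 / a ^ 3 := by
    rw [he2, he3, he4]; field_simp
  have eup : a * (1 + Real.exp (-2 * α) + Real.exp (-3 * α) + 5 * Real.exp (-4 * α)) =
      a + 1 / a + 1 / a ^ 2 + 5 / a ^ 3 := by
    rw [he2, he3, he4]; field_simp
  have hlow0 : 0 < 1 + Real.exp (-2 * α) + Real.exp (-3 * α) - 3 * Real.exp (-4 * α) := by
    rw [he2, he3, he4]
    have h4 : 3 * (1 / a ^ 4) ≤ 1 / a ^ 3 := by
      rw [mul_one_div, div_le_div_iff₀ (by positivity) (by positivity)]; nlinarith [pow_nonneg ha0.le 3]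
    have : 0 < 1 / a ^ 2 := by positivity
    linarith
  have hκ : adsFreeEnergy α - α = Real.log (adsRate a / a) := by
    rw [adsFreeEnergy, Real.log_div hpos.ne' ha0.ne', ha_def, Real.log_exp]
  rw [hκ]
  constructor
  · refine Real.log_le_log hlow0 ?_
    rw [le_div_iff₀ ha0, mul_comm, elow]
    exact (adsRate_mem_Icc_exact3 ha6).1
  · refine Real.log_le_log (div_pos hpos ha0) ?_
    rw [div_le_iff₀ ha0, mul_comm, eup]
    exact (adsRate_mem_Icc_exact3 ha6).2

namespace LowTempWin

/-! ### The order-`a⁻³` lower bound from the kernel census of irreducible wall-returning `x`-bridges -/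

/-- Power of a coefficient list. [cite: BeatonGuttmannJensen2012Adsorption, §1 (p. 2)] -/
def ppow (p : List ℤ) : ℕ → List ℤ
  | 0 => [1]
  | k + 1 => pmul p (ppow p k)

/-- `ppow` is the power. [folklore] -/
private theorem peval_ppow (p : List ℤ) (a : ℝ) : ∀ k : ℕ, peval (ppow p k) a = peval p a ^ k
  | 0 => by simp [ppow]
  | k + 1 => by rw [ppow, peval_pmul, peval_ppow p a k, pow_succ]; ring

/-- The tree's census `c(m, ·)` of irreducible pieces by wall visits (`AdsIrr.cTab`, kernel-certified for `m ≤ 16`)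
as an integer coefficient list. [cite: BeatonGuttmannJensen2012Adsorption, §1 (p. 2)] -/
def cz (m : ℕ) : List ℤ := (AdsIrr.cTab m).map fun n : ℕ => (n : ℤ)

/-- A cast coefficient list evaluates to the tree's `getD`-sum. [folklore] -/
private theorem peval_map_natCast (a : ℝ) : ∀ l : List ℕ,
    peval (l.map fun n : ℕ => (n : ℤ)) a = ∑ v ∈ Finset.range l.length, ((l.getD v 0 : ℕ) : ℝ) * a ^ v
  | [] => by simp
  | c :: l => by
      rw [List.map_cons, peval_cons, peval_map_natCast a l, List.length_cons, Finset.sum_range_succ', Finset.mul_sum]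
      simp only [List.getD_cons_zero, List.getD_cons_succ, pow_zero, mul_one, Int.cast_natCast]
      rw [add_comm]
      congr 1
      refine Finset.sum_congr rfl fun v _ => ?_
      ring

/-- `cz m` evaluates to the tree's certified lower bound `f_m(a) = Σ_v c(m,v) a^v`. [cite: BeatonGuttmannJensen2012Adsorption, §1 (p. 2)] -/
theorem peval_cz (m : ℕ) (a : ℝ) : peval (cz m) a = AdsIrr.fTab a m := by
  rw [cz, peval_map_natCast, AdsIrr.fTab]

/-- `N₋(a) = a⁵ + a³ + a² − a − 3`, the numerator of the lower rate `Λ₋ = a + 1/a + 1/a² − 1/a³ − 3/a⁴`.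
[cite: BeatonGuttmannJensen2012Adsorption, §1 (p. 2)] -/
def lowN : List ℤ := [-3, -1, 1, 1, 0, 1]

/-- The renewal certificate polynomial `Σ_{m=1}^{9} c_m(a)·a^{4m}·N₋^{9−m} − N₋^9` (pieces of length `≤ 9`;
lengths `2, 3` have none). [cite: BeatonGuttmannJensen2012Adsorption, §1 (p. 2)] [cite: MadrasSlade1993, §4.2, eq. (4.2.2)–(4.2.4) (pp. 89–91)] -/
def lowP : List ℤ :=
  padd (pmul (cz 1) (pmul (pzeros 4 [1]) (ppow lowN 8)))
  (padd (pmul (cz 4) (pmul (pzeros 16 [1]) (ppow lowN 5)))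
  (padd (pmul (cz 5) (pmul (pzeros 20 [1]) (ppow lowN 4)))
  (padd (pmul (cz 6) (pmul (pzeros 24 [1]) (ppow lowN 3)))
  (padd (pmul (cz 7) (pmul (pzeros 28 [1]) (ppow lowN 2)))
  (padd (pmul (cz 8) (pmul (pzeros 32 [1]) (ppow lowN 1)))
  (padd (pmul (cz 9) (pzeros 36 [1]))
    (psmul (-1) (ppow lowN 9))))))))

/-- **The renewal certificate**: `lowP(3 + t)` has non-negative coefficients (degree `45`).
[cite: BeatonGuttmannJensen2012Adsorption, §1 (p. 2)] -/
theorem lowP_cert : nonnegB (pshift 3 lowP) = true := by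
  native_decide

end LowTempWin

/-- **`a + 1/a + 1/a² − 1/a³ − 3/a⁴ ≤ e^{κ(a)}` for `a ≥ 3`** — the order-`a⁻³` lower bound, from the tree's
kernel-certified census of irreducible wall-returning `x`-bridges (`AdsIrr.cTab`, lengths `≤ 9`: the wall step, the
bumps of widths `1–6` and heights `≤ 2`, …) through the renewal certificate principle
`AdsIrr.adsorbedAbove_of_irreducible_lowerBounds`: `Σ_{m ≤ 9} f_m(a) Λ₋^{−m} ≥ 1` for `Λ₋ = a + 1/a + 1/a² − 1/a³ − 3/a⁴`.
[cite: BeatonGuttmannJensen2012Adsorption, §1 (p. 2)] [cite: MadrasSlade1993, §4.2, eq. (4.2.2)–(4.2.4) (pp. 89–91)] -/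
theorem fourth_order_le_adsRate {a : ℝ} (ha : 3 ≤ a) : a + 1 / a + 1 / a ^ 2 - 1 / a ^ 3 - 3 / a ^ 4 ≤ adsRate a := by
  have ha0 : 0 < a := by linarith
  set n := LowTempWin.peval LowTempWin.lowN a with hn_def
  have hn : n = a ^ 5 + a ^ 3 + a ^ 2 - a - 3 := by
    rw [hn_def]; simp only [LowTempWin.lowN, LowTempWin.peval_cons, LowTempWin.peval_nil]; push_cast; ring
  have hn0 : 0 < n := by
    rw [hn]
    have h5 : (243 : ℝ) ≤ a ^ 5 := by nlinarith [pow_le_pow_left₀ (by norm_num : (0:ℝ) ≤ 3) ha 5]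
    nlinarith [pow_nonneg ha0.le 3, pow_nonneg ha0.le 2]
  have hΛ : a + 1 / a + 1 / a ^ 2 - 1 / a ^ 3 - 3 / a ^ 4 = n / a ^ 4 := by
    rw [hn]
    field_simp
  have key : 0 ≤ LowTempWin.peval LowTempWin.lowP a := by
    have := LowTempWin.peval_nonneg LowTempWin.lowP_cert (t := a - 3) (by linarith)
    rwa [LowTempWin.peval_pshift, show ((3 : ℤ) : ℝ) + (a - 3) = a by push_cast; ring] at this
  have hsum : 1 ≤ ∑ m ∈ Icc 1 9, LowTempWin.peval (LowTempWin.cz m) a / (n / a ^ 4) ^ m := by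
    rw [← sub_nonneg]
    have e : ∑ m ∈ Icc 1 9, LowTempWin.peval (LowTempWin.cz m) a / (n / a ^ 4) ^ m - 1 =
        LowTempWin.peval LowTempWin.lowP a / n ^ 9 := by
      rw [← Finset.Ico_add_one_right_eq_Icc, Finset.sum_Ico_eq_sum_range]
      simp only [Finset.sum_range_succ, Finset.sum_range_zero, Nat.reduceAdd, LowTempWin.lowP, LowTempWin.peval_padd,
        LowTempWin.peval_pmul, LowTempWin.peval_psmul, LowTempWin.peval_ppow, LowTempWin.peval_pzeros, ← hn_def,
        LowTempWin.peval_cons, LowTempWin.peval_nil, Int.cast_one, Int.cast_neg]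
      have h2 : LowTempWin.peval (LowTempWin.cz 2) a = 0 := by simp [LowTempWin.cz, AdsIrr.cTab]
      have h3 : LowTempWin.peval (LowTempWin.cz 3) a = 0 := by simp [LowTempWin.cz, AdsIrr.cTab]
      rw [h2, h3]
      field_simp
      ring
    rw [e]
    exact div_nonneg key (pow_nonneg hn0.le 9)
  have hfF : ∀ m ∈ Icc 1 9, LowTempWin.peval (LowTempWin.cz m) a ≤ AdsIrr.Fw m a := by
    intro m hm
    rw [LowTempWin.peval_cz]
    have hm' : m ∈ Icc 1 16 := by
      rw [Finset.mem_Icc] at hm ⊢; omega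
    exact AdsIrr.fTab_le_Fw ha0.le m hm'
  have hA : AdsorbedAbove a (n / a ^ 4) :=
    AdsIrr.adsorbedAbove_of_irreducible_lowerBounds ha0 (by positivity) (fun m => LowTempWin.peval (LowTempWin.cz m) a)
      hfF hsum
  rw [hΛ]
  exact le_adsRate_of_adsorbedAbove ha0.le (by positivity) hA
/-- **The sandwich to the order `a⁻³`: `a + 1/a + 1/a² − 1/a³ − 3/a⁴ ≤ e^{κ(a)} ≤ a + 1/a + 1/a² − 1/a³ + 12/a⁴` for
`a ≥ 8`.** [cite: BeatonBousquetMelouDeGierDuminilCopinGuttmann2014, §3 (arXiv:1109.0358v5 pp. 9–10: «on the square lattice, μ(y) is asymptotic to y» — Rychlewski–Whittington 2011)] -/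
theorem adsRate_mem_Icc_exact4 {a : ℝ} (ha : 8 ≤ a) :
    adsRate a ∈ Set.Icc (a + 1 / a + 1 / a ^ 2 - 1 / a ^ 3 - 3 / a ^ 4) (a + 1 / a + 1 / a ^ 2 - 1 / a ^ 3 + 12 / a ^ 4) :=
  ⟨fourth_order_le_adsRate (by linarith), adsRate_le_exact4 ha⟩

/-- **`a³ · (e^{κ(a)} − a − 1/a − 1/a²) ∈ [−1 − 3/a, −1 + 12/a]` for `a ≥ 8`.**
[cite: BeatonBousquetMelouDeGierDuminilCopinGuttmann2014, §3 (arXiv:1109.0358v5 pp. 9–10: «on the square lattice, μ(y) is asymptotic to y» — Rychlewski–Whittington 2011)] -/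
theorem cube_mul_adsRate_sub_mem_Icc {a : ℝ} (ha : 8 ≤ a) :
    a ^ 3 * (adsRate a - a - 1 / a - 1 / a ^ 2) ∈ Set.Icc (-1 - 3 / a) (-1 + 12 / a) := by
  have ha0 : 0 < a := by linarith
  obtain ⟨hlo, hup⟩ := adsRate_mem_Icc_exact4 ha
  constructor
  · have e : a ^ 3 * (a + 1 / a + 1 / a ^ 2 - 1 / a ^ 3 - 3 / a ^ 4 - a - 1 / a - 1 / a ^ 2) = -1 - 3 / a := by
      field_simp; ring
    calc -1 - 3 / a = a ^ 3 * (a + 1 / a + 1 / a ^ 2 - 1 / a ^ 3 - 3 / a ^ 4 - a - 1 / a - 1 / a ^ 2) := e.symm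
      _ ≤ a ^ 3 * (adsRate a - a - 1 / a - 1 / a ^ 2) := by nlinarith [pow_pos ha0 3]
  · have e : a ^ 3 * (a + 1 / a + 1 / a ^ 2 - 1 / a ^ 3 + 12 / a ^ 4 - a - 1 / a - 1 / a ^ 2) = -1 + 12 / a := by
      field_simp; ring
    calc a ^ 3 * (adsRate a - a - 1 / a - 1 / a ^ 2)
        ≤ a ^ 3 * (a + 1 / a + 1 / a ^ 2 - 1 / a ^ 3 + 12 / a ^ 4 - a - 1 / a - 1 / a ^ 2) := by nlinarith [pow_pos ha0 3]
      _ = -1 + 12 / a := e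

/-- **`a³ · (e^{κ(a)} − a − 1/a − 1/a²) → −1` as `a → ∞`**: the coefficient of `a⁻³` in the low-temperature expansion
of the adsorbing half-plane self-avoiding walk on `ℤ²` is exactly `−1` (`e^{κ(a)} = a + 1/a + 1/a² − 1/a³ + O(a⁻⁴)`:
against the unit bumps' `−3`, the width-two bumps and the height-two excursion contribute `+2`).
[cite: BeatonBousquetMelouDeGierDuminilCopinGuttmann2014, §3 (arXiv:1109.0358v5 pp. 9–10: «on the square lattice, μ(y) is asymptotic to y» — Rychlewski–Whittington 2011)]
[cite: JansevanRensburgWhittington2013, Corollary 1 and Theorem 5 (arXiv v4 p. 9): ratio asymptotics] -/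
theorem tendsto_cube_mul_adsRate_sub :
    Tendsto (fun a : ℝ => a ^ 3 * (adsRate a - a - 1 / a - 1 / a ^ 2)) atTop (𝓝 (-1)) := by
  have hlo : Tendsto (fun a : ℝ => -1 - 3 * a⁻¹) atTop (𝓝 (-1)) := by
    simpa using (tendsto_inv_atTop_zero.const_mul (3 : ℝ)).const_sub (-1 : ℝ)
  have hup : Tendsto (fun a : ℝ => -1 + 12 * a⁻¹) atTop (𝓝 (-1)) := by
    simpa using (tendsto_inv_atTop_zero.const_mul (12 : ℝ)).const_add (-1 : ℝ)
  refine tendsto_of_tendsto_of_tendsto_of_le_of_le' hlo hup ?_ ?_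
  · filter_upwards [eventually_ge_atTop 8] with a ha
    have h := (cube_mul_adsRate_sub_mem_Icc ha).1
    rwa [div_eq_mul_inv] at h
  · filter_upwards [eventually_ge_atTop 8] with a ha
    have h := (cube_mul_adsRate_sub_mem_Icc ha).2
    rwa [div_eq_mul_inv] at h

/-- **`κ(α) − α ∈ [log (1 + e^{−2α} + e^{−3α} − e^{−4α} − 3e^{−5α}), log (1 + e^{−2α} + e^{−3α} − e^{−4α} + 12e^{−5α})]`
for `α ≥ log 8`**: `κ(α) = α + e^{−2α} + e^{−3α} − (3/2)e^{−4α} + O(e^{−5α})`.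
[cite: BeatonBousquetMelouDeGierDuminilCopinGuttmann2014, §3 (arXiv:1109.0358v5 pp. 9–10: «on the square lattice, μ(y) is asymptotic to y» — Rychlewski–Whittington 2011)]
[cite: BeatonGuttmannJensen2012Adsorption, §1 p. 2 (arXiv:1110.6695v1: «κ(α) is asymptotic to α»)] -/
theorem adsFreeEnergy_sub_mem_Icc_exact4 {α : ℝ} (hα : Real.log 8 ≤ α) :
    adsFreeEnergy α - α ∈ Set.Icc
      (Real.log (1 + Real.exp (-2 * α) + Real.exp (-3 * α) - Real.exp (-4 * α) - 3 * Real.exp (-5 * α)))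
      (Real.log (1 + Real.exp (-2 * α) + Real.exp (-3 * α) - Real.exp (-4 * α) + 12 * Real.exp (-5 * α))) := by
  set a := Real.exp α with ha_def
  have ha8 : 8 ≤ a := by
    rw [ha_def, ← Real.exp_log (by norm_num : (0 : ℝ) < 8)]
    exact Real.exp_le_exp.2 hα
  have ha0 : 0 < a := Real.exp_pos α
  have hpos := adsRate_pos ha0.le
  have he2 : Real.exp (-2 * α) = 1 / a ^ 2 := by
    rw [ha_def, ← Real.exp_nat_mul, one_div, ← Real.exp_neg]; ring_nf
  have he3 : Real.exp (-3 * α) = 1 / a ^ 3 := by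
    rw [ha_def, ← Real.exp_nat_mul, one_div, ← Real.exp_neg]; ring_nf
  have he4 : Real.exp (-4 * α) = 1 / a ^ 4 := by
    rw [ha_def, ← Real.exp_nat_mul, one_div, ← Real.exp_neg]; ring_nf
  have he5 : Real.exp (-5 * α) = 1 / a ^ 5 := by
    rw [ha_def, ← Real.exp_nat_mul, one_div, ← Real.exp_neg]; ring_nf
  have elow : a * (1 + Real.exp (-2 * α) + Real.exp (-3 * α) - Real.exp (-4 * α) - 3 * Real.exp (-5 * α)) =
      a + 1 / a + 1 / a ^ 2 - 1 / a ^ 3 - 3 / a ^ 4 := by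
    rw [he2, he3, he4, he5]; field_simp
  have eup : a * (1 + Real.exp (-2 * α) + Real.exp (-3 * α) - Real.exp (-4 * α) + 12 * Real.exp (-5 * α)) =
      a + 1 / a + 1 / a ^ 2 - 1 / a ^ 3 + 12 / a ^ 4 := by
    rw [he2, he3, he4, he5]; field_simp
  have hlow0 : 0 < 1 + Real.exp (-2 * α) + Real.exp (-3 * α) - Real.exp (-4 * α) - 3 * Real.exp (-5 * α) := by
    rw [he2, he3, he4, he5]
    have h4 : 1 / a ^ 4 ≤ 1 / a ^ 3 := by
      rw [div_le_div_iff₀ (by positivity) (by positivity)]; nlinarith [pow_nonneg ha0.le 3]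
    have h5 : 3 * (1 / a ^ 5) ≤ 1 / a ^ 2 := by
      rw [mul_one_div, div_le_div_iff₀ (by positivity) (by positivity)]
      have h3 : (512 : ℝ) ≤ a ^ 3 := by
        nlinarith [mul_nonneg (sub_nonneg.2 ha8) (by positivity : (0 : ℝ) ≤ a ^ 2 + 8 * a + 64)]
      nlinarith [mul_nonneg (sq_nonneg a) (sub_nonneg.2 h3)]
    have : 0 < 1 / a ^ 3 := by positivity
    linarith
  have hκ : adsFreeEnergy α - α = Real.log (adsRate a / a) := by
    rw [adsFreeEnergy, Real.log_div hpos.ne' ha0.ne', ha_def, Real.log_exp]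
  rw [hκ]
  constructor
  · refine Real.log_le_log hlow0 ?_
    rw [le_div_iff₀ ha0, mul_comm, elow]
    exact (adsRate_mem_Icc_exact4 ha8).1
  · refine Real.log_le_log (div_pos hpos ha0) ?_
    rw [div_le_iff₀ ha0, mul_comm, eup]
    exact (adsRate_mem_Icc_exact4 ha8).2

/-- **The sandwich to the order `a⁻⁴`: `a + 1/a + 1/a² − 1/a³ − 3/a⁴ ≤ e^{κ(a)} ≤ a + 1/a + 1/a² − 1/a³ − 3/a⁴ + 32/a⁵` for
`a ≥ 10`.** [cite: BeatonBousquetMelouDeGierDuminilCopinGuttmann2014, §3 (arXiv:1109.0358v5 pp. 9–10: «on the square lattice, μ(y) is asymptotic to y» — Rychlewski–Whittington 2011)] -/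
theorem adsRate_mem_Icc_exact5 {a : ℝ} (ha : 10 ≤ a) :
    adsRate a ∈ Set.Icc (a + 1 / a + 1 / a ^ 2 - 1 / a ^ 3 - 3 / a ^ 4)
      (a + 1 / a + 1 / a ^ 2 - 1 / a ^ 3 - 3 / a ^ 4 + 32 / a ^ 5) :=
  ⟨fourth_order_le_adsRate (by linarith), adsRate_le_exact5 ha⟩

/-- **`a⁴ · (e^{κ(a)} − a − 1/a − 1/a² + 1/a³) ∈ [−3, −3 + 32/a]` for `a ≥ 10`.**
[cite: BeatonBousquetMelouDeGierDuminilCopinGuttmann2014, §3 (arXiv:1109.0358v5 pp. 9–10: «on the square lattice, μ(y) is asymptotic to y» — Rychlewski–Whittington 2011)] -/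
theorem pow_four_mul_adsRate_sub_mem_Icc {a : ℝ} (ha : 10 ≤ a) :
    a ^ 4 * (adsRate a - a - 1 / a - 1 / a ^ 2 + 1 / a ^ 3) ∈ Set.Icc (-3) (-3 + 32 / a) := by
  have ha0 : 0 < a := by linarith
  obtain ⟨hlo, hup⟩ := adsRate_mem_Icc_exact5 ha
  constructor
  · have e : a ^ 4 * (a + 1 / a + 1 / a ^ 2 - 1 / a ^ 3 - 3 / a ^ 4 - a - 1 / a - 1 / a ^ 2 + 1 / a ^ 3) = -3 := by
      field_simp; ring
    calc (-3 : ℝ) = a ^ 4 * (a + 1 / a + 1 / a ^ 2 - 1 / a ^ 3 - 3 / a ^ 4 - a - 1 / a - 1 / a ^ 2 + 1 / a ^ 3) := e.symm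
      _ ≤ a ^ 4 * (adsRate a - a - 1 / a - 1 / a ^ 2 + 1 / a ^ 3) := by nlinarith [pow_pos ha0 4]
  · have e : a ^ 4 * (a + 1 / a + 1 / a ^ 2 - 1 / a ^ 3 - 3 / a ^ 4 + 32 / a ^ 5 - a - 1 / a - 1 / a ^ 2 + 1 / a ^ 3) =
        -3 + 32 / a := by
      field_simp; ring
    calc a ^ 4 * (adsRate a - a - 1 / a - 1 / a ^ 2 + 1 / a ^ 3)
        ≤ a ^ 4 * (a + 1 / a + 1 / a ^ 2 - 1 / a ^ 3 - 3 / a ^ 4 + 32 / a ^ 5 - a - 1 / a - 1 / a ^ 2 + 1 / a ^ 3) := by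
          nlinarith [pow_pos ha0 4]
      _ = -3 + 32 / a := e

/-- **`a⁴ · (e^{κ(a)} − a − 1/a − 1/a² + 1/a³) → −3` as `a → ∞`**: the coefficient of `a⁻⁴` in the low-temperature
expansion of the adsorbing half-plane self-avoiding walk on `ℤ²` is exactly `−3`
(`e^{κ(a)} = a + 1/a + 1/a² − 1/a³ − 3/a⁴ + O(a⁻⁵)`).
[cite: BeatonBousquetMelouDeGierDuminilCopinGuttmann2014, §3 (arXiv:1109.0358v5 pp. 9–10: «on the square lattice, μ(y) is asymptotic to y» — Rychlewski–Whittington 2011)]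
[cite: JansevanRensburgWhittington2013, Corollary 1 and Theorem 5 (arXiv v4 p. 9): ratio asymptotics] -/
theorem tendsto_pow_four_mul_adsRate_sub :
    Tendsto (fun a : ℝ => a ^ 4 * (adsRate a - a - 1 / a - 1 / a ^ 2 + 1 / a ^ 3)) atTop (𝓝 (-3)) := by
  have hlo : Tendsto (fun _ : ℝ => (-3 : ℝ)) atTop (𝓝 (-3)) := tendsto_const_nhds
  have hup : Tendsto (fun a : ℝ => -3 + 32 * a⁻¹) atTop (𝓝 (-3)) := by
    simpa using (tendsto_inv_atTop_zero.const_mul (32 : ℝ)).const_add (-3 : ℝ)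
  refine tendsto_of_tendsto_of_tendsto_of_le_of_le' hlo hup ?_ ?_
  · filter_upwards [eventually_ge_atTop 10] with a ha
    exact (pow_four_mul_adsRate_sub_mem_Icc ha).1
  · filter_upwards [eventually_ge_atTop 10] with a ha
    have h := (pow_four_mul_adsRate_sub_mem_Icc ha).2
    rwa [div_eq_mul_inv] at h

/-- **`κ(α) − α ∈ [log (1 + e^{−2α} + e^{−3α} − e^{−4α} − 3e^{−5α}), log (1 + e^{−2α} + e^{−3α} − e^{−4α} − 3e^{−5α} + 32e^{−6α})]`
for `α ≥ log 10`**: `κ(α) = α + e^{−2α} + e^{−3α} − (3/2)e^{−4α} − 4e^{−5α} + O(e^{−6α})`.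
[cite: BeatonBousquetMelouDeGierDuminilCopinGuttmann2014, §3 (arXiv:1109.0358v5 pp. 9–10: «on the square lattice, μ(y) is asymptotic to y» — Rychlewski–Whittington 2011)]
[cite: BeatonGuttmannJensen2012Adsorption, §1 p. 2 (arXiv:1110.6695v1: «κ(α) is asymptotic to α»)] -/
theorem adsFreeEnergy_sub_mem_Icc_exact5 {α : ℝ} (hα : Real.log 10 ≤ α) :
    adsFreeEnergy α - α ∈ Set.Icc
      (Real.log (1 + Real.exp (-2 * α) + Real.exp (-3 * α) - Real.exp (-4 * α) - 3 * Real.exp (-5 * α)))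
      (Real.log (1 + Real.exp (-2 * α) + Real.exp (-3 * α) - Real.exp (-4 * α) - 3 * Real.exp (-5 * α) +
        32 * Real.exp (-6 * α))) := by
  set a := Real.exp α with ha_def
  have ha10 : 10 ≤ a := by
    rw [ha_def, ← Real.exp_log (by norm_num : (0 : ℝ) < 10)]
    exact Real.exp_le_exp.2 hα
  have ha0 : 0 < a := Real.exp_pos α
  have hpos := adsRate_pos ha0.le
  have he2 : Real.exp (-2 * α) = 1 / a ^ 2 := by
    rw [ha_def, ← Real.exp_nat_mul, one_div, ← Real.exp_neg]; ring_nf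
  have he3 : Real.exp (-3 * α) = 1 / a ^ 3 := by
    rw [ha_def, ← Real.exp_nat_mul, one_div, ← Real.exp_neg]; ring_nf
  have he4 : Real.exp (-4 * α) = 1 / a ^ 4 := by
    rw [ha_def, ← Real.exp_nat_mul, one_div, ← Real.exp_neg]; ring_nf
  have he5 : Real.exp (-5 * α) = 1 / a ^ 5 := by
    rw [ha_def, ← Real.exp_nat_mul, one_div, ← Real.exp_neg]; ring_nf
  have he6 : Real.exp (-6 * α) = 1 / a ^ 6 := by
    rw [ha_def, ← Real.exp_nat_mul, one_div, ← Real.exp_neg]; ring_nf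
  have elow : a * (1 + Real.exp (-2 * α) + Real.exp (-3 * α) - Real.exp (-4 * α) - 3 * Real.exp (-5 * α)) =
      a + 1 / a + 1 / a ^ 2 - 1 / a ^ 3 - 3 / a ^ 4 := by
    rw [he2, he3, he4, he5]; field_simp
  have eup : a * (1 + Real.exp (-2 * α) + Real.exp (-3 * α) - Real.exp (-4 * α) - 3 * Real.exp (-5 * α) +
      32 * Real.exp (-6 * α)) = a + 1 / a + 1 / a ^ 2 - 1 / a ^ 3 - 3 / a ^ 4 + 32 / a ^ 5 := by
    rw [he2, he3, he4, he5, he6]; field_simp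
  have hlow0 : 0 < 1 + Real.exp (-2 * α) + Real.exp (-3 * α) - Real.exp (-4 * α) - 3 * Real.exp (-5 * α) := by
    rw [he2, he3, he4, he5]
    have h4 : 1 / a ^ 4 ≤ 1 / a ^ 3 := by
      rw [div_le_div_iff₀ (by positivity) (by positivity)]; nlinarith [pow_nonneg ha0.le 3]
    have h5 : 3 * (1 / a ^ 5) ≤ 1 / a ^ 2 := by
      rw [mul_one_div, div_le_div_iff₀ (by positivity) (by positivity)]
      have h3 : (1000 : ℝ) ≤ a ^ 3 := by
        nlinarith [mul_nonneg (sub_nonneg.2 ha10) (by positivity : (0 : ℝ) ≤ a ^ 2 + 10 * a + 100)]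
      nlinarith [mul_nonneg (sq_nonneg a) (sub_nonneg.2 h3)]
    have : 0 < 1 / a ^ 3 := by positivity
    linarith
  have hκ : adsFreeEnergy α - α = Real.log (adsRate a / a) := by
    rw [adsFreeEnergy, Real.log_div hpos.ne' ha0.ne', ha_def, Real.log_exp]
  rw [hκ]
  constructor
  · refine Real.log_le_log hlow0 ?_
    rw [le_div_iff₀ ha0, mul_comm, elow]
    exact (adsRate_mem_Icc_exact5 ha10).1
  · refine Real.log_le_log (div_pos hpos ha0) ?_
    rw [div_le_iff₀ ha0, mul_comm, eup]
    exact (adsRate_mem_Icc_exact5 ha10).2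

end Literature.Probability.RandomPlanarGeometry.SAW.Zd

end
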